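import Summits.ValiantsHypothesis.ValiantsHypothesis.Theorems.LacunarySymmetroidMatrixDescartesCensusCUChamber2339P1
import Summits.ValiantsHypothesis.ValiantsHypothesis.Theorems.LacunarySymmetroidMatrixDescartesCensusCUChamber2339P2
import Summits.ValiantsHypothesis.ValiantsHypothesis.Theorems.LacunarySymmetroidMatrixDescartesCensusCUChamber2339P3
import Summits.ValiantsHypothesis.ValiantsHypothesis.Theorems.LacunarySymmetroidMatrixDescartesCensusCUChamber2339P4
import Summits.ValiantsHypothesis.ValiantsHypothesis.Theorems.LacunarySymmetroidMatrixDescartesCensusCUChamber2339P5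

/-!
# `MatrixDescartes` census — chamber 2339 by the CHAMBER-UNIFORM CHECKED CHECKER (second layer, PIECE cover): per-piece kernel evaluations, part 3 of 3 (the chamber cites 413 kB of piece data: over the 330 kB MAIN SIZE line, so the evaluations are split ≤ 5 per file and `…Main` only assembles)

HONEST FRAMING.  Object-search cell `pub-symmetroid`, door-A target `DoorA26 := PosRootLawAt 2 6 19` (stmt-ValiantsHypothesis-19979; OPEN, typed,
never asserted); census line `Cruxes/DoorA26/Lines/census.lean`, stub `stub_easyChambers`.  Chamber 2339 of theory g6's table gets its complete door-A row
`doorA26_on_chamber2339` from ONE kernel evaluation of `CU.checkTable2` (`…CensusCUPieces`): orientation `s = +`: odd definite triangle 015; `s = −`: vertex-ordered piece cover (11 certified pieces: G3(0,2,4), G3(0,2,4), G3(0,2,4), G3(0,2,4)…).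
The piece certificates (engine val-sym-eng-1 g3 kit «m4u5-cover-1» (vertex-ordered piece covers with adaptive deepening; recipes T1 G3 / T3 W / T5 signed M4; preloaded exact pieces of g2 kits j299488 / j301520), exact in-job conversion; multipliers re-derived exactly by door-p2 g8's cuconv.py /
pieces.py, AM–GM split flows rounded to a dyadic grid and re-balanced on single-pair arcs) are too large for one file, so the certified pieces are named
definitions (`CU.Cert2` data, nothing asserted) in the `…P<k>` files and the argmax tree in `…Main` cites them (pattern of `…CUChamber706Main`).  Necessary-condition
certificates against HYPOTHETICAL twenties on one chamber cone; nothing here bears on `V = 19`, on other chambers, on `DoorA26` as a whole (OPEN), on the crux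
`MatrixDescartes` (stmt-ValiantsHypothesis-18050) or on `VP ≠ VNP`.

[folklore] Kernel replay of exact certificates (val-sym-eng-1 g3 on val-sym-door-p2 g8's checker); elementary.
-/

-- `Summit.ValiantsHypothesis.ValiantsHypothesis.…` repeats a component by the D-0017 layout
-- (single-conjunct summit), which the `dupNamespace` linter flags; the name is mandated.
set_option linter.dupNamespace false

namespace Summit.ValiantsHypothesis.ValiantsHypothesis.Theorems.LacunarySymmetroidMatrixDescartes.Census


set_option maxHeartbeats 40000000 in
set_option maxRecDepth 100000 in
/-- The certified piece `c2339m_p4` passes `CU.certOK2` in its own piece context (one kernel evaluation). [folklore] -/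
theorem c2339m_p4_ok :
    CU.certOK2 (CU.ofSigma (chamber 2339)) false (CU.baseCtx (CU.ofSigma (chamber 2339)) ++ CU.maxCtx ⟨-1, 0, 0, 2, -1, 0⟩ [⟨1, -1, -1, 1, 0, 0⟩, ⟨0, -1, 2, -1, 0, 0⟩, ⟨1, 0, 0, -2, 0, 1⟩, ⟨-1, 1, 0, 0, 1, -1⟩]) [] c2339m_p4 = true := by
  decide +kernel

end Summit.ValiantsHypothesis.ValiantsHypothesis.Theorems.LacunarySymmetroidMatrixDescartes.Census
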